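import Literature.Probability.Percolation.CerfTwoArms
import Literature.Probability.Percolation.CerfCentralInequality
import Literature.Probability.Percolation.CerfIterationProofs
import Literature.Probability.Percolation.CerfSec8Proofs
import Literature.Probability.Percolation.CerfProp41Proofs
import Literature.Probability.Percolation.CerfLem51Proofs
import HarnessLib

/-!
# Cerf 2015, Proposition 5.2 (the initial two-arms estimate) from Lemma 5.1

Topic `Literature/Probability/Percolation`. Sorry-free derivation of the named fact
`Literature.Probability.Percolation.Cerf2015_prop_5_2` (`CerfTwoArms.lean`) — "there exists a constant `κ` depending
on `d` and `p` only such that `P_p(two-arms(0,n)) ≤ κ ln n/√n`" (vendored for `n ≥ 2`) — from the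
central inequality `Cerf2015_lem_5_1` (`CerfCentralInequality.lean`), following the proof
printed after Lemma 5.1 (p. 10): "the number of clusters in `Λ(n+ℓ)` which intersect the inner
boundary is bounded by `|∂ⁱⁿΛ(n+ℓ)| ≤ 2d(2(n+ℓ)+1)^{d−1}`; taking `ℓ` small and `n` large gives
Proposition 5.2". R. Cerf, *A lower bound on the two-arms exponent for critical percolation on the
lattice*, Ann. Probab. 43 (2015) 2458–2480, doi:10.1214/14-AOP940 (arXiv:1306.3105, p. 9–10).

## The argument, as formalised

With the repaired collection `𝒞 = reachingClusters (zdGraph d) Λ(m+2) Λ(m+1)` of Lemma 5.1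
(`ℓ = 2`): distinct members of `𝒞` are disjoint and each contains a site of `∂ⁱⁿΛ(m+2)`, so
`|𝒞| ≤ |∂ⁱⁿΛ(m+2)| ≤ 2d(2m+5)^{d−1}` pointwise (`card_reachingClusters_le_card_innerBoundary`),
hence `E(√|𝒞|) ≤ (2d(2m+5)^{d−1})^{1/2}`; with `|Λ(m)| = (2m+1)^d` the first term of Lemma 5.1
is `≤ 2d (2d 5^{d−1})^{1/2} ln m/√m`, and its second term is `O(m^{−d})`
(`card_box_sq_mul_exp_le`), whence `P(two-arms(0, 2m+2)) ≤ κ₀ ln m/√m` for `m ≥ 2`. For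
`n ≥ 6` take `m = ⌊(n−2)/2⌋ ≥ n/4` and use that `k ↦ two-arms(0,k)` is decreasing
(`siteTwoArms_antitone`); for `2 ≤ n ≤ 5` the bound `1 ≤ (√5/ln 2) ln n/√n` suffices.

## Main results

* `Cerf2015_prop_5_2_of_lem_5_1 : Cerf2015_lem_5_1 → Cerf2015_prop_5_2`;
* `Cerf2015_prop_5_2_holds : Cerf2015_prop_5_2` (with `Cerf2015_lem_5_1_of_prop_4_1`,
  `CerfLem51Proofs.lean`, and `Cerf2015_prop_4_1_holds`, `CerfProp41Proofs.lean`).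
-/

noncomputable section

open MeasureTheory Literature.Probability.LatticeModels Literature.Probability.Percolation
open scoped Finset

namespace Literature.Probability.Percolation

section CritPerc

variable {V : Type*} {d : ℕ}

/-- **`|𝒞| ≤ |∂ⁱⁿL|`** (p. 10: "the number of clusters in `Λ(n+ℓ)` which intersect the inner
boundary is bounded by `|∂ⁱⁿΛ(n+ℓ)|`"): distinct members of `reachingClusters G L Λ` are
disjoint and each contains a site of `∂ⁱⁿL`. [cite: Cerf2015, §5 p. 10] -/
theorem card_reachingClusters_le_card_innerBoundary {G : SimpleGraph V} [DecidableEq V]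
    [G.LocallyFinite] (L Λ : Finset V) (ω : SiteConfig V) :
    #(reachingClusters G L Λ ω) ≤ #(innerBoundary G L) := by
  have h := card_filter_meets_le (G := G) (L := L) (Λ := Λ) (ω := ω) (B := L) le_rfl
  have hfilter : (reachingClusters G L Λ ω).filter (fun C => (C ∩ L).Nonempty) =
      reachingClusters G L Λ ω := by
    refine Finset.filter_true_of_mem fun C hC => ?_
    obtain ⟨x, -, ⟨w, hw, hwx⟩, hCx⟩ := exists_root_of_mem_reachingClusters hC
    have hwC : w ∈ C := (hCx w).2 hwx
    exact ⟨w, Finset.mem_inter.2 ⟨hwC, (mem_innerBoundary_iff.1 hw).1⟩⟩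
  rwa [hfilter] at h

/-- **Cerf 2015, Proposition 5.2 from Lemma 5.1** (p. 10). [cite: Cerf2015, Prop 5.2] -/
theorem Cerf2015_prop_5_2_of_lem_5_1 (h51 : Cerf2015_lem_5_1) : Cerf2015_prop_5_2 := by
  intro d hd p hp0 hp1
  have hd1 : 1 ≤ d := by omega
  have h1p : 0 < 1 - (p : ℝ) := by linarith
  set a : ℝ := (p : ℝ) ^ 2 * (1 - p) ^ 2 with ha
  have hapos : 0 < a := by positivity
  set CT : ℝ := 4 * d / ((p : ℝ) * (1 - p)) *
    (16 ^ d * Real.exp (((3 * d : ℕ) : ℝ) ^ 2 / (8 * a))) with hCT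
  have hCT0 : 0 ≤ CT := by positivity
  set c₁ : ℝ := 2 * d * Real.sqrt (2 * d * 5 ^ (d - 1)) with hc₁
  have hc₁0 : 0 ≤ c₁ := by positivity
  set κ₀ : ℝ := c₁ + CT / Real.log 2 with hκ₀
  have hκ₀0 : 0 ≤ κ₀ := by
    have : 0 ≤ CT / Real.log 2 := div_nonneg hCT0 (Real.log_nonneg one_le_two)
    positivity
  -- Step 1: the bound along the radii `2m + 2`, `m ≥ 2`
  have hstep : ∀ m : ℕ, 2 ≤ m →
      (sitePercolation (Site d) p).real (siteTwoArms d 0 (2 * m + 2)) ≤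
        κ₀ * Real.log m / Real.sqrt m := by
    intro m hm
    have hm1 : 1 ≤ m := by omega
    have hm0 : (0 : ℝ) < m := by positivity
    have hm1r : (1 : ℝ) ≤ m := by exact_mod_cast hm1
    have hlog0 : 0 ≤ Real.log m := Real.log_nonneg hm1r
    have h51m := h51 d hd p hp0 hp1 m 2 hm1 le_rfl
    -- `E(√|𝒞|) ≤ √(2d (2m+5)^{d-1})`
    set B : ℝ := 2 * d * (2 * (m : ℝ) + 5) ^ (d - 1) with hB
    have hBpos : 0 < B := by positivity
    have hN : ∀ ω : SiteConfig (Site d),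
        (#(reachingClusters (zdGraph d) (box d (m + 2)) (box d (m + 1)) ω) : ℝ) ≤ B := by
      intro ω
      have h1 := card_reachingClusters_le_card_innerBoundary (G := zdGraph d)
        (box d (m + 2)) (box d (m + 1)) ω
      have h2 := card_innerBoundary_box_le (d := d) (m + 2)
      calc (#(reachingClusters (zdGraph d) (box d (m + 2)) (box d (m + 1)) ω) : ℝ)
          ≤ ((2 * d * (2 * (m + 2) + 1) ^ (d - 1) : ℕ) : ℝ) := by exact_mod_cast h1.trans h2
        _ = B := by simp only [hB]; push_cast; ring
    have hint : ∫ ω, Real.sqrt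
        (#(reachingClusters (zdGraph d) (box d (m + 2)) (box d (m + 1)) ω) : ℝ)
          ∂(sitePercolation (Site d) p) ≤ Real.sqrt B := by
      refine integral_sqrt_le_sqrt_of_le_indicator_sum (sitePercolation (Site d) p)
        (∅ : Finset Unit) (fun _ => (∅ : Set (SiteConfig (Site d))))
        (fun ω => (#(reachingClusters (zdGraph d) (box d (m + 2)) (box d (m + 1)) ω) : ℝ))
        (A := B) (K := 0) (q := 0) (fun ω => Nat.cast_nonneg _) le_rfl ?_ (fun _ h => ?_) hBpos
        ?_
      · intro ω; simpa using hN ω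
      · simp at h
      · simp
    -- first term
    have hT1 : 2 * d * Real.log m / Real.sqrt ((box d m).card : ℝ) *
        ∫ ω, Real.sqrt (#(reachingClusters (zdGraph d) (box d (m + 2)) (box d (m + 1)) ω) : ℝ)
          ∂(sitePercolation (Site d) p) ≤ c₁ * Real.log m / Real.sqrt m := by
      have hcard : ((box d m).card : ℝ) = (2 * (m : ℝ) + 1) ^ d := by
        rw [card_box]; push_cast; ring
      have hs1 : 0 < Real.sqrt ((2 * (m : ℝ) + 1) ^ (d - 1)) := Real.sqrt_pos.2 (by positivity)
      have hs2 : 0 < Real.sqrt (2 * (m : ℝ) + 1) := Real.sqrt_pos.2 (by positivity)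
      have hsplit : Real.sqrt ((2 * (m : ℝ) + 1) ^ d) =
          Real.sqrt ((2 * (m : ℝ) + 1) ^ (d - 1)) * Real.sqrt (2 * (m : ℝ) + 1) := by
        rw [← Real.sqrt_mul (by positivity), ← pow_succ, Nat.sub_add_cancel hd1]
      have hBle : Real.sqrt B ≤
          Real.sqrt (2 * d * 5 ^ (d - 1)) * Real.sqrt ((2 * (m : ℝ) + 1) ^ (d - 1)) := by
        rw [← Real.sqrt_mul (by positivity)]
        apply Real.sqrt_le_sqrt
        simp only [hB]
        have h15 : (2 * (m : ℝ) + 5) ^ (d - 1) ≤ (5 : ℝ) ^ (d - 1) * (2 * (m : ℝ) + 1) ^ (d - 1) := by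
          rw [← mul_pow]
          exact pow_le_pow_left₀ (by positivity) (by linarith) _
        calc 2 * (d : ℝ) * (2 * (m : ℝ) + 5) ^ (d - 1)
            ≤ 2 * (d : ℝ) * ((5 : ℝ) ^ (d - 1) * (2 * (m : ℝ) + 1) ^ (d - 1)) :=
              mul_le_mul_of_nonneg_left h15 (by positivity)
          _ = 2 * d * 5 ^ (d - 1) * (2 * (m : ℝ) + 1) ^ (d - 1) := by ring
      have hsm : Real.sqrt (m : ℝ) ≤ Real.sqrt (2 * (m : ℝ) + 1) :=
        Real.sqrt_le_sqrt (by linarith)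
      have hsm0 : 0 < Real.sqrt (m : ℝ) := Real.sqrt_pos.2 hm0
      calc 2 * d * Real.log m / Real.sqrt ((box d m).card : ℝ) *
            ∫ ω, Real.sqrt (#(reachingClusters (zdGraph d) (box d (m + 2)) (box d (m + 1)) ω) : ℝ)
              ∂(sitePercolation (Site d) p)
          ≤ 2 * d * Real.log m / Real.sqrt ((box d m).card : ℝ) * Real.sqrt B :=
            mul_le_mul_of_nonneg_left hint (by positivity)
        _ ≤ 2 * d * Real.log m / Real.sqrt ((box d m).card : ℝ) *
              (Real.sqrt (2 * d * 5 ^ (d - 1)) * Real.sqrt ((2 * (m : ℝ) + 1) ^ (d - 1))) :=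
            mul_le_mul_of_nonneg_left hBle (by positivity)
        _ = c₁ * Real.log m / Real.sqrt (2 * (m : ℝ) + 1) := by
            rw [hcard, hsplit]
            simp only [hc₁]
            field_simp
        _ ≤ c₁ * Real.log m / Real.sqrt m :=
            div_le_div_of_nonneg_left (by positivity) hsm0 hsm
    -- second term
    have hT2 : 4 * d / ((p : ℝ) * (1 - p)) * ((box d (m + 1)).card : ℝ) ^ 2 *
        Real.exp (-2 * Real.log m ^ 2 * (p : ℝ) ^ 2 * (1 - p) ^ 2) ≤
        CT / Real.log 2 * Real.log m / Real.sqrt m := by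
      have hexp : Real.exp (-2 * Real.log m ^ 2 * (p : ℝ) ^ 2 * (1 - p) ^ 2) =
          Real.exp (-2 * Real.log m ^ 2 * a) := by
        simp only [ha]; ring_nf
      have h2 := card_box_sq_mul_exp_le (d := d) hapos hm
      have h3 := div_pow_le_log_div_sqrt_mul_sqrt hd1 hCT0 le_rfl hm le_rfl hm1 (X := 0) (k := 1)
      rw [Nat.cast_one, one_pow, div_one, add_zero, Real.sqrt_one, mul_one] at h3
      calc 4 * d / ((p : ℝ) * (1 - p)) * ((box d (m + 1)).card : ℝ) ^ 2 *
            Real.exp (-2 * Real.log m ^ 2 * (p : ℝ) ^ 2 * (1 - p) ^ 2)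
          = 4 * d / ((p : ℝ) * (1 - p)) *
              (((box d (m + 1)).card : ℝ) ^ 2 * Real.exp (-2 * Real.log m ^ 2 * a)) := by
            rw [hexp]; ring
        _ ≤ 4 * d / ((p : ℝ) * (1 - p)) *
              (16 ^ d * Real.exp (((3 * d : ℕ) : ℝ) ^ 2 / (8 * a)) / (m : ℝ) ^ d) :=
            mul_le_mul_of_nonneg_left h2 (by positivity)
        _ = CT / (m : ℝ) ^ d := by simp only [hCT]; ring
        _ ≤ CT / Real.log 2 * Real.log m / Real.sqrt m := h3
    calc (sitePercolation (Site d) p).real (siteTwoArms d 0 (2 * m + 2)) ≤ _ := h51m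
      _ ≤ c₁ * Real.log m / Real.sqrt m + CT / Real.log 2 * Real.log m / Real.sqrt m :=
          add_le_add hT1 hT2
      _ = κ₀ * Real.log m / Real.sqrt m := by simp only [hκ₀]; ring
  -- Step 2: all radii `n ≥ 2`
  refine ⟨2 * κ₀ + Real.sqrt 5 / Real.log 2, fun n hn => ?_⟩
  have hlog2 : 0 < Real.log 2 := Real.log_pos one_lt_two
  have hn0 : (0 : ℝ) < n := by positivity
  have hlogn : Real.log 2 ≤ Real.log n := Real.log_le_log two_pos (by exact_mod_cast hn)
  have hlogn0 : 0 ≤ Real.log n := hlog2.le.trans hlogn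
  have hsn : 0 < Real.sqrt (n : ℝ) := Real.sqrt_pos.2 hn0
  have hP1 : (sitePercolation (Site d) p).real (siteTwoArms d 0 n) ≤ 1 := measureReal_le_one
  have hsmall : 1 ≤ Real.sqrt 5 / Real.log 2 * Real.log n / Real.sqrt n ↔
      Real.sqrt n * Real.log 2 ≤ Real.sqrt 5 * Real.log n := by
    rw [div_mul_eq_mul_div, div_div, le_div_iff₀ (by positivity), one_mul, mul_comm (Real.log 2)]
  have hbig_nonneg : 0 ≤ 2 * κ₀ * Real.log n / Real.sqrt n := by positivity
  have hsmall_nonneg : 0 ≤ Real.sqrt 5 / Real.log 2 * Real.log n / Real.sqrt n := by positivity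
  rw [show (2 * κ₀ + Real.sqrt 5 / Real.log 2) * Real.log n / Real.sqrt n =
      2 * κ₀ * Real.log n / Real.sqrt n + Real.sqrt 5 / Real.log 2 * Real.log n / Real.sqrt n by
    ring]
  rcases le_or_gt n 5 with hn5 | hn5
  · -- `2 ≤ n ≤ 5`
    have h5 : Real.sqrt (n : ℝ) ≤ Real.sqrt 5 := Real.sqrt_le_sqrt (by exact_mod_cast hn5)
    have h1 : 1 ≤ Real.sqrt 5 / Real.log 2 * Real.log n / Real.sqrt n := by
      rw [hsmall]
      exact mul_le_mul h5 hlogn hlog2.le (Real.sqrt_nonneg _)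
    linarith
  · -- `n ≥ 6`: `m = (n - 2)/2 ≥ 2`, `2m + 2 ≤ n`, `n ≤ 4m`
    set m : ℕ := (n - 2) / 2 with hm
    have hm2 : 2 ≤ m := by omega
    have hmn : 2 * m + 2 ≤ n := by omega
    have hn4m : n ≤ 4 * m := by omega
    have hm0 : (0 : ℝ) < m := by positivity
    have hmono : (sitePercolation (Site d) p).real (siteTwoArms d 0 n) ≤
        (sitePercolation (Site d) p).real (siteTwoArms d 0 (2 * m + 2)) :=
      measureReal_mono (siteTwoArms_antitone (by omega) hmn) (measure_ne_top _ _)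
    have hlogm : Real.log m ≤ Real.log n :=
      Real.log_le_log hm0 (by exact_mod_cast (show m ≤ n by omega))
    have hlogm0 : 0 ≤ Real.log m := Real.log_nonneg (by exact_mod_cast (show 1 ≤ m by omega))
    have hsqrt : Real.sqrt n ≤ 2 * Real.sqrt m := by
      rw [show (2 : ℝ) = Real.sqrt 4 by rw [show (4 : ℝ) = 2 ^ 2 by norm_num, Real.sqrt_sq zero_le_two],
        ← Real.sqrt_mul (by norm_num)]
      exact Real.sqrt_le_sqrt (by exact_mod_cast hn4m)
    have hsm : 0 < Real.sqrt (m : ℝ) := Real.sqrt_pos.2 hm0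
    have h2 : κ₀ * Real.log m / Real.sqrt m ≤ 2 * κ₀ * Real.log n / Real.sqrt n := by
      rw [div_le_div_iff₀ hsm hsn]
      calc κ₀ * Real.log m * Real.sqrt n ≤ κ₀ * Real.log n * (2 * Real.sqrt m) := by gcongr
        _ = 2 * κ₀ * Real.log n * Real.sqrt m := by ring
    linarith [hstep m hm2]

/-- **Cerf 2015, Proposition 5.2, discharged**: for `d ≥ 2` and `0 < p < 1` there is `κ` with
`P_p(two-arms(0,n)) ≤ κ ln n/√n` for `n ≥ 2`. [cite: Cerf2015, Prop 5.2] -/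
theorem Cerf2015_prop_5_2_holds : Cerf2015_prop_5_2 :=
  Cerf2015_prop_5_2_of_lem_5_1 (Cerf2015_lem_5_1_of_prop_4_1 Cerf2015_prop_4_1_holds)

end CritPerc

end Literature.Probability.Percolation
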